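import Mathlib
import Literature.Computability.AlgebraicComplexity.ZModCircuitIntegerCodes
import Literature.Computability.AlgebraicComplexity.DeterminantalIdealComplexityDescent
import Literature.Computability.AlgebraicComplexity.ConstantFreeValiant
import HarnessLib

/-!
# Route TameSensitivity — the growth lemma `TameGrowth` (item stmt-ValiantsHypothesis-23474)

`TameGrowth` is the support item B1b of the route: a fan-in-two real circuit all of whose gates
have fan-in `≥ 1`, with constants and sum weights of modulus `≤ 2^R` and all formal degrees `≤ D`,
has abs-value twin (every constant replaced by its modulus) whose value at the all-ones point is
`≤ 2^((R+1)·D·(size+2))`.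

This is the abs-evaluation twin of the corrected growth lemma of route NumTame
(`Theorems/NumTameGrowthLemma.lean`), ported from Boolean points over `ℂ` to an arbitrary real
point with coordinates of modulus `≤ 1`:

* `norm_gateValues_le` — along a gate list with fan-in `≤ 2`, operand constants and weights of
  modulus `≤ 2^R` and all formal degrees `≥ 1`, gate `j` satisfies `|g_j(x)| ≤ 2^((R+1)(j+2)·fdeg_j)`;
* `one_le_of_mem_gateFormalDegrees` — fan-in `≥ 1` everywhere forces every formal degree `≥ 1`
  (input nodes have formal degree `1` in Bürgisser's convention, so the `prod []` obstruction that
  falsified the uncorrected NumTame lemma is exactly what the hypothesis `1 ≤ g.fanIn` removes);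
* `norm_eval_le` — the circuit-level bound `|Q(x)| ≤ 2^((R+1)·D·(size Q + 2))`;
* `tameGrowth` — the item (stated verbatim, so that the gate matches it against the route decl
  `Theses.TameSensitivity.TameGrowth` without this module importing the route file), by applying
  `norm_eval_le` to
  `Q = P.mapConsts (fun c => |c|)` at the all-ones point (size, fan-ins and formal degrees are
  unchanged by `mapConsts`, and its constants are the moduli of those of `P`).

Honest framing: exponent bookkeeping for a support item of an open route; nothing here bears on
VP ≠ VNP itself.

## References

* P. Bürgisser, *On defining integers and proving arithmetic circuit lower bounds*, Comput.
  Complexity 18 (2009), §2.2 (formal degree). [cite: Burgisser2006, §2.2]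
* P. Bürgisser, *Completeness and Reduction in Algebraic Complexity Theory* (2000), Def. 2.1,
  §4.1 (circuits, constants). [cite: Burgisser2000, Def. 2.1]
* P. Hrubeš, *On ε-sensitive monotone computations*, Comput. Complexity 29 (2020), §4
  (the radius of the coefficient region, where this growth bound is consumed). [cite: Hrubes2020, §4]
-/

set_option linter.dupNamespace false

noncomputable section

open MvPolynomial

namespace Summit.ValiantsHypothesis.ValiantsHypothesis.Theorems.TameSensitivityGrowth

open Literature.Computability.AlgebraicComplexity ArithCircuit

variable {σ : Type*}

/-! ### Formal degrees are `≥ 1` when every gate has an operand -/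

/-- An operand has formal degree `≥ 1` as soon as all earlier gates do (input nodes and junk
references have formal degree `1`). [cite: Burgisser2006, §2.2] -/
theorem Operand.one_le_formalDegree (degs : List ℕ) (hdegs : ∀ d ∈ degs, 1 ≤ d)
    (u : Operand ℝ σ) : 1 ≤ u.formalDegree degs := by
  cases u with
  | var i => simp [Operand.formalDegree]
  | const c => simp [Operand.formalDegree]
  | gate j =>
    simp only [Operand.formalDegree, List.getD_eq_getElem?_getD]
    by_cases hj : j < degs.length
    · rw [List.getElem?_eq_getElem hj]
      exact hdegs _ (List.getElem_mem _)
    · rw [List.getElem?_eq_none (by omega)]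
      simp

/-- A gate with at least one operand has formal degree `≥ 1` as soon as all earlier gates do.
[cite: Burgisser2006, §2.2] -/
theorem Gate.one_le_formalDegree (degs : List ℕ) (hdegs : ∀ d ∈ degs, 1 ≤ d)
    (g : Gate ℝ σ) (hg : 1 ≤ g.fanIn) : 1 ≤ g.formalDegree degs := by
  cases g with
  | sum args =>
    simp only [Gate.fanIn, Gate.args, List.length_map] at hg
    rcases args with _ | ⟨a, rest⟩
    · simp at hg
    · simp only [Gate.formalDegree, List.map_cons, List.foldr_cons]
      exact (Operand.one_le_formalDegree degs hdegs a.2).trans (le_max_left _ _)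
  | prod args =>
    simp only [Gate.fanIn, Gate.args] at hg
    rcases args with _ | ⟨a, rest⟩
    · simp at hg
    · simp only [Gate.formalDegree, List.map_cons, List.sum_cons]
      exact (Operand.one_le_formalDegree degs hdegs a).trans (Nat.le_add_right _ _)

/-- **Fan-in `≥ 1` everywhere ⇒ every formal degree is `≥ 1`.** [cite: Burgisser2006, §2.2] -/
theorem one_le_of_mem_gateFormalDegrees (gs : List (Gate ℝ σ)) (hfan : ∀ g ∈ gs, 1 ≤ g.fanIn) :
    ∀ d ∈ gateFormalDegrees gs, 1 ≤ d := by
  induction gs using List.reverseRecOn with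
  | nil => intro d hd; simp [gateFormalDegrees] at hd
  | append_singleton gs g ih =>
    intro d hd
    have ih' := ih (fun g' hg' => hfan g' (by simp [hg']))
    rw [gateFormalDegrees_append_singleton, List.mem_append, List.mem_singleton] at hd
    rcases hd with hd | rfl
    · exact ih' d hd
    · exact Gate.one_le_formalDegree _ ih' g (hfan g (by simp))

/-! ### The growth lemma at a point with coordinates of modulus `≤ 1` -/

/-- A point with coordinates of modulus `≤ 1` evaluates variables to modulus `≤ 1`. [folklore] -/
theorem norm_eval_X_le (x : σ → ℝ) (hx : ∀ i, ‖x i‖ ≤ 1) (i : σ) :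
    ‖eval x (X i : MvPolynomial σ ℝ)‖ ≤ 1 := by
  rw [eval_X]
  exact hx i

/-- **Operands.** If every earlier gate value satisfies `‖v_j(x)‖ ≤ 2^((R+1)(j+2)·d_j)`, then an
operand of gate number `J = |vals|` with constant of modulus `≤ 2^R` has
`‖u(x)‖ ≤ 2^((R+1)(J+1)·fdeg u)`. [cite: Burgisser2006, §2.2] -/
theorem norm_eval_operand_le (x : σ → ℝ) (hx : ∀ i, ‖x i‖ ≤ 1) (R : ℕ)
    (vals : List (MvPolynomial σ ℝ)) (degs : List ℕ)
    (hlen : vals.length = degs.length)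
    (h : ∀ j (hj : j < vals.length),
      ‖eval x vals[j]‖ ≤ 2 ^ ((R + 1) * (j + 2) * degs[j]'(hlen ▸ hj)))
    (u : Operand ℝ σ) (hu : ∀ a, u = Operand.const a → ‖a‖ ≤ 2 ^ R) :
    ‖eval x (u.eval vals)‖ ≤
      (2 : ℝ) ^ ((R + 1) * (vals.length + 1) * u.formalDegree degs) := by
  cases u with
  | var i =>
    simp only [Operand.eval, Operand.formalDegree, mul_one]
    exact (norm_eval_X_le x hx i).trans (one_le_pow₀ (by norm_num))
  | const c =>
    simp only [Operand.eval, Operand.formalDegree, eval_C, mul_one]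
    calc ‖c‖ ≤ 2 ^ R := hu c rfl
      _ ≤ 2 ^ ((R + 1) * (vals.length + 1)) :=
          pow_le_pow_right₀ (by norm_num) (by nlinarith)
  | gate j =>
    simp only [Operand.eval, Operand.formalDegree, List.getD_eq_getElem?_getD]
    by_cases hj : j < vals.length
    · rw [List.getElem?_eq_getElem hj, List.getElem?_eq_getElem (hlen ▸ hj)]
      simp only [Option.getD_some]
      refine (h j hj).trans (pow_le_pow_right₀ (by norm_num) ?_)
      exact Nat.mul_le_mul_right _ (Nat.mul_le_mul_left _ (by omega))
    · rw [List.getElem?_eq_none (by omega), List.getElem?_eq_none (by omega)]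
      simp only [Option.getD_none, map_zero, norm_zero]
      positivity

/-- **Gates.** Under the same hypothesis, a gate of fan-in `≤ 2` with weights of modulus `≤ 2^R`
and formal degree `D ≥ 1` has `‖g(x)‖ ≤ 2^((R+1)(J+2)·D)`: products add formal degrees, a
weighted sum costs one factor `2·2^R ≤ 2^((R+1)·D)`. [cite: Burgisser2006, §2.2] -/
theorem norm_eval_gate_le (x : σ → ℝ) (hx : ∀ i, ‖x i‖ ≤ 1) (R : ℕ)
    (vals : List (MvPolynomial σ ℝ)) (degs : List ℕ)
    (hlen : vals.length = degs.length)
    (h : ∀ j (hj : j < vals.length),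
      ‖eval x vals[j]‖ ≤ 2 ^ ((R + 1) * (j + 2) * degs[j]'(hlen ▸ hj)))
    (g : Gate ℝ σ) (hfan : g.fanIn ≤ 2)
    (hconst : ∀ u ∈ g.args, ∀ a, u = Operand.const a → ‖a‖ ≤ 2 ^ R)
    (hw : ∀ args, g = Gate.sum args → ∀ a ∈ args, ‖a.1‖ ≤ 2 ^ R)
    (hdeg : 1 ≤ g.formalDegree degs) :
    ‖eval x (g.eval vals)‖ ≤
      (2 : ℝ) ^ ((R + 1) * (vals.length + 2) * g.formalDegree degs) := by
  have hop : ∀ u ∈ g.args, ‖eval x (u.eval vals)‖ ≤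
      (2 : ℝ) ^ ((R + 1) * (vals.length + 1) * u.formalDegree degs) :=
    fun u hu => norm_eval_operand_le x hx R vals degs hlen h u (hconst u hu)
  cases g with
  | prod args =>
    simp only [Gate.eval, Gate.formalDegree]
    simp only [Gate.args] at hop
    -- any number of factors: moduli multiply, formal degrees add
    have key : ∀ l : List (Operand ℝ σ), (∀ u ∈ l, ‖eval x (u.eval vals)‖ ≤
        (2 : ℝ) ^ ((R + 1) * (vals.length + 1) * u.formalDegree degs)) →
        ‖eval x (l.map fun u => u.eval vals).prod‖ ≤
          (2 : ℝ) ^ ((R + 1) * (vals.length + 1) * (l.map fun u => u.formalDegree degs).sum) := by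
      intro l hl
      induction l with
      | nil => simp
      | cons u rest ih =>
        simp only [List.map_cons, List.prod_cons, List.sum_cons, map_mul, norm_mul]
        rw [Nat.mul_add, pow_add]
        exact mul_le_mul (hl u (by simp)) (ih fun v hv => hl v (by simp [hv])) (norm_nonneg _)
          (by positivity)
    refine (key args hop).trans (pow_le_pow_right₀ (by norm_num) ?_)
    exact Nat.mul_le_mul_right _ (Nat.mul_le_mul_left _ (by omega))
  | sum args =>
    have hw' : ∀ a ∈ args, ‖a.1‖ ≤ 2 ^ R := hw args rfl
    simp only [Gate.fanIn, Gate.args, List.length_map] at hfan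
    simp only [Gate.args, List.mem_map, forall_exists_index, and_imp,
      forall_apply_eq_imp_iff₂] at hop
    -- one summand, given a bound `D` on its formal degree
    have hterm : ∀ a ∈ args, ∀ D, a.2.formalDegree degs ≤ D →
        ‖eval x (a.1 • a.2.eval vals)‖ ≤
          (2 : ℝ) ^ R * 2 ^ ((R + 1) * (vals.length + 1) * D) := by
      intro a ha D hD
      rw [smul_eval, norm_mul]
      exact mul_le_mul (hw' a ha) ((hop a ha).trans
        (pow_le_pow_right₀ (by norm_num) (Nat.mul_le_mul_left _ hD))) (norm_nonneg _)
        (by positivity)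
    -- the exponent step `2 · 2^R · 2^((R+1)(J+1)D) ≤ 2^((R+1)(J+2)D)` for `D ≥ 1`
    have hfin : ∀ D, 1 ≤ D → 2 * ((2 : ℝ) ^ R * 2 ^ ((R + 1) * (vals.length + 1) * D)) ≤
        2 ^ ((R + 1) * (vals.length + 2) * D) := by
      intro D hD
      rw [← mul_assoc, ← pow_succ', ← pow_add]
      refine pow_le_pow_right₀ (by norm_num) ?_
      have : R + 1 ≤ (R + 1) * D := Nat.le_mul_of_pos_right _ hD
      nlinarith
    simp only [Gate.eval, Gate.formalDegree] at hdeg ⊢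
    rcases args with _ | ⟨a, _ | ⟨b, _ | ⟨c, rest⟩⟩⟩
    · simp
    · simp only [List.map_cons, List.map_nil, List.sum_cons, List.sum_nil, add_zero,
        List.foldr_cons, List.foldr_nil] at hdeg ⊢
      have h1 := hterm a (by simp) _ (le_max_left (a.2.formalDegree degs) 0)
      have hpos : (0 : ℝ) ≤ 2 ^ R * 2 ^ ((R + 1) * (vals.length + 1) *
          max (a.2.formalDegree degs) 0) := by positivity
      exact (h1.trans (by linarith)).trans (hfin _ hdeg)
    · simp only [List.map_cons, List.map_nil, List.sum_cons, List.sum_nil, add_zero,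
        List.foldr_cons, List.foldr_nil] at hdeg ⊢
      have ha := hterm a (by simp) _ (le_max_left (a.2.formalDegree degs)
        (max (b.2.formalDegree degs) 0))
      have hb := hterm b (by simp) _ ((le_max_left (b.2.formalDegree degs) 0).trans
        (le_max_right (a.2.formalDegree degs) _))
      rw [map_add]
      refine ((norm_add_le _ _).trans (add_le_add ha hb)).trans ?_
      rw [← two_mul]
      exact hfin _ hdeg
    · simp at hfan

/-- **The growth lemma along a gate list**: with fan-in `≤ 2`, operand constants and weights of
modulus `≤ 2^R`, and all formal degrees `≥ 1`, every gate value at a point with coordinates of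
modulus `≤ 1` satisfies `‖g_j(x)‖ ≤ 2^((R+1)(j+2)·fdeg_j)`. [cite: Burgisser2006, §2.2] -/
theorem norm_gateValues_le (x : σ → ℝ) (hx : ∀ i, ‖x i‖ ≤ 1) (R : ℕ) (gs : List (Gate ℝ σ))
    (hfan : ∀ g ∈ gs, g.fanIn ≤ 2)
    (hconst : ∀ g ∈ gs, ∀ u ∈ g.args, ∀ a, u = Operand.const a → ‖a‖ ≤ 2 ^ R)
    (hw : ∀ args, Gate.sum args ∈ gs → ∀ a ∈ args, ‖a.1‖ ≤ 2 ^ R)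
    (hdeg : ∀ d ∈ gateFormalDegrees gs, 1 ≤ d) :
    ∀ j (hj : j < (gateValues gs).length),
      ‖eval x (gateValues gs)[j]‖ ≤
        (2 : ℝ) ^ ((R + 1) * (j + 2) * (gateFormalDegrees gs)[j]'(by simpa using hj)) := by
  induction gs using List.reverseRecOn with
  | nil => intro j hj; simp at hj
  | append_singleton gs g ih =>
    intro j hj
    have hlen : (gateValues gs).length = (gateFormalDegrees gs).length := by simp
    have ih' := ih (fun g' hg' => hfan g' (by simp [hg']))
      (fun g' hg' => hconst g' (by simp [hg']))
      (fun args hargs => hw args (by simp [hargs]))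
      (fun d hd => hdeg d (by simp [gateFormalDegrees_append_singleton, hd]))
    simp only [gateValues_append_singleton, gateFormalDegrees_append_singleton]
    rw [gateValues_append_singleton, List.length_append, List.length_singleton] at hj
    by_cases hj' : j < (gateValues gs).length
    · rw [List.getElem_append_left hj', List.getElem_append_left (hlen ▸ hj')]
      exact ih' j hj'
    · have hjeq : j = (gateValues gs).length := by omega
      subst hjeq
      rw [List.getElem_append_right (le_refl _)]
      rw [List.getElem_append_right (by simp)]
      simp only [Nat.sub_self, List.getElem_cons_zero, gateValues_length, gateFormalDegrees_length]
      have hg := norm_eval_gate_le x hx R (gateValues gs) (gateFormalDegrees gs) hlen ih' g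
        (hfan g (by simp)) (fun u hu => hconst g (by simp) u hu) (fun args hargs => hw args (by
          rw [← hargs]; simp)) (hdeg _ (by simp [gateFormalDegrees_append_singleton]))
      simpa [gateValues_length] using hg

/-! ### From the constant list of a circuit to the per-gate hypotheses -/

/-- A constant operand of a gate of `Q` is a constant of `Q`. [cite: Burgisser2000, §4.1] -/
theorem mem_consts_of_mem_args (Q : ArithCircuit ℝ σ) (g : Gate ℝ σ) (hg : g ∈ Q.gates)
    (u : Operand ℝ σ) (hu : u ∈ g.args) (a : ℝ) (hua : u = Operand.const a) : a ∈ Q.consts := by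
  subst hua
  simp only [consts, List.mem_append, List.mem_flatMap]
  refine Or.inl ⟨g, hg, ?_⟩
  cases g with
  | sum args =>
    simp only [Gate.args, List.mem_map] at hu
    obtain ⟨b, hb, hb2⟩ := hu
    simp only [Gate.consts, List.mem_append, List.mem_map, List.mem_flatMap]
    exact Or.inr ⟨b, hb, by rw [hb2]; simp [Operand.consts]⟩
  | prod args =>
    simp only [Gate.args] at hu
    simp only [Gate.consts, List.mem_flatMap]
    exact ⟨_, hu, by simp [Operand.consts]⟩

/-- A weight of a sum gate of `Q` is a constant of `Q`. [cite: Burgisser2000, §4.1] -/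
theorem mem_consts_of_mem_sum (Q : ArithCircuit ℝ σ) (args : List (ℝ × Operand ℝ σ))
    (hg : Gate.sum args ∈ Q.gates) (a : ℝ × Operand ℝ σ) (ha : a ∈ args) : a.1 ∈ Q.consts := by
  simp only [consts, List.mem_append, List.mem_flatMap]
  refine Or.inl ⟨_, hg, ?_⟩
  simp only [Gate.consts, List.mem_append, List.mem_map]
  exact Or.inl ⟨a, ha, rfl⟩

/-- A constant output operand of `Q` is a constant of `Q`. [cite: Burgisser2000, §4.1] -/
theorem mem_consts_of_output (Q : ArithCircuit ℝ σ) (a : ℝ) (hout : Q.output = Operand.const a) :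
    a ∈ Q.consts := by
  simp [consts, hout, Operand.consts]

/-! ### The circuit-level bound -/

/-- **Circuit-level growth bound.** A fan-in-two real circuit with all gates of fan-in `≥ 1`,
constants and weights of modulus `≤ 2^R` and formal degree `≤ D` satisfies
`|Q(x)| ≤ 2^((R+1)·D·(size Q + 2))` at every point with coordinates of modulus `≤ 1` (no bound on
the formal degrees of the individual gates is needed: gate `j` is controlled by its own formal
degree, and the output only reads gates of formal degree `≤ fdeg Q`). [cite: Burgisser2006, §2.2] -/
theorem norm_eval_le (x : σ → ℝ) (hx : ∀ i, ‖x i‖ ≤ 1) (R D : ℕ) (Q : ArithCircuit ℝ σ)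
    (hfan : Q.IsFanInTwo) (hfan1 : ∀ g ∈ Q.gates, 1 ≤ g.fanIn)
    (hconst : ∀ c ∈ Q.consts, ‖c‖ ≤ 2 ^ R) (hout : Q.formalDegree ≤ D) :
    ‖eval x Q.eval‖ ≤ (2 : ℝ) ^ ((R + 1) * D * (Q.size + 2)) := by
  have hlen : (gateValues Q.gates).length = (gateFormalDegrees Q.gates).length := by simp
  have hvals := norm_gateValues_le x hx R Q.gates hfan
    (fun g hg u hu a hua => hconst a (mem_consts_of_mem_args Q g hg u hu a hua))
    (fun args hargs a ha => hconst a.1 (mem_consts_of_mem_sum Q args hargs a ha))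
    (one_le_of_mem_gateFormalDegrees Q.gates hfan1)
  have hop := norm_eval_operand_le x hx R (gateValues Q.gates) (gateFormalDegrees Q.gates) hlen
    hvals Q.output (fun a ha => hconst a (mem_consts_of_output Q a ha))
  rw [ArithCircuit.eval]
  refine hop.trans (pow_le_pow_right₀ (by norm_num) ?_)
  rw [gateValues_length]
  have hfd : Q.output.formalDegree (gateFormalDegrees Q.gates) ≤ D := hout
  calc (R + 1) * (Q.gates.length + 1) * Q.output.formalDegree (gateFormalDegrees Q.gates)
      ≤ (R + 1) * (Q.size + 2) * D :=
        Nat.mul_le_mul (Nat.mul_le_mul_left _ (by rw [ArithCircuit.size]; omega)) hfd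
    _ = (R + 1) * D * (Q.size + 2) := Nat.mul_right_comm _ _ _

/-! ### The item -/

/-- **`TameGrowth`** (route TameSensitivity, item B1b): for a fan-in-two real circuit `P` with
all gates of fan-in `≥ 1`, constants and weights of modulus `≤ 2^R`, and all formal degrees
`≤ D`, the abs-value twin `P.mapConsts (fun c => |c|)` evaluates at the all-ones point to at most
`2^((R+1)·D·(size P + 2))`. [cite: Burgisser2006, §2.2] -/
theorem tameGrowth : ∀ (n R D : ℕ) (P : Literature.Computability.AlgebraicComplexity.ArithCircuit ℝ (Fin n × Fin n)), P.IsFanInTwo → (∀ g ∈ P.gates, 1 ≤ g.fanIn) → (∀ c ∈ P.consts, |c| ≤ (2 : ℝ) ^ R) → (∀ d ∈ Literature.Computability.AlgebraicComplexity.ArithCircuit.gateFormalDegrees P.gates, d ≤ D) → P.formalDegree ≤ D → MvPolynomial.eval (fun _ => (1 : ℝ)) (Literature.Computability.AlgebraicComplexity.ArithCircuit.mapConsts (fun c : ℝ => |c|) P).eval ≤ (2 : ℝ) ^ ((R + 1) * D * (P.size + 2)) := by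
  intro n R D P hfan hfan1 hconst _ hout
  have key := norm_eval_le (fun _ : Fin n × Fin n => (1 : ℝ)) (fun _ => by simp) R D
    (P.mapConsts fun c : ℝ => |c|) (hfan.mapConsts _) ?_ ?_ ?_
  · rw [size_mapConsts, Real.norm_eq_abs] at key
    exact (le_abs_self _).trans key
  · intro g hg
    simp only [ArithCircuit.mapConsts, List.mem_map] at hg
    obtain ⟨g', hg', rfl⟩ := hg
    rw [Gate.fanIn_map]
    exact hfan1 g' hg'
  · intro c hc
    rw [consts_mapConsts, List.mem_map] at hc
    obtain ⟨c', hc', rfl⟩ := hc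
    rw [Real.norm_eq_abs, abs_abs]
    exact hconst c' hc'
  · rw [formalDegree_mapConsts]
    exact hout

end Summit.ValiantsHypothesis.ValiantsHypothesis.Theorems.TameSensitivityGrowth

end
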